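import Summits.HodgeConjecture.HodgeConjecture.Theorems.Ring2AbelianAllAndreCrossCorrespondence
import Mathlib.LinearAlgebra.Matrix.BilinearForm
import HarnessLib

/-!
# Ring 2 · sub-cell AbelianAll (ALL ABELIAN VARIETIES), André axis, part XIV-b — THE `p = 1` RUNG OF THE
# FIBRE-CLASS LEFSCHETZ OPERATOR FROM PRODUCTS OF DIVISORS: on a compact pencil of abelian `d`-folds, `d ≥ 2`,
# whose invariant `H²` is spanned by divisor classes on ONE fibre, cup-with-the-fibre-class `H² → H⁴` has an
# ALGEBRAIC quasi-inverse in the sense of (β′_f) — the explicit cycle `∑ᵢ Dᵢ × (Aᵢ · Hᵈ⁻²)` on `𝒳 × 𝒳`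

HONEST FRAMING (page 1, verbatim): **research route, not a corollary; conditional on HC_CM plus one named
minimal statement.** Cell line: research route conditional on HC_CM; not a corollary; Q11.4-sentence-2
already refuted in dim ≥ 3. Nothing in this file proves a case of the Hodge conjecture for an abelian variety.
`HC_CM` = `Theses.RankFourFaces.CMAbelianHodge` (a BINDER), item `Theses.RankFourFaces.CMToAbelian` (stmt-16267)
OPEN and not closed here. Seat `pub-hodge-ring2-ab-andre-2`, gen 6; owed item (o15) of RING2-MAP §AbelianAll
AA2.39–AA2.40 — DONE in the kernel.

## What is proved (theorems only; no definition, no named fact, no sorry, no Hodge-conjecture input)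

After gens 4–5 the two topological supply nodes (κ), (φ) of the Lefschetz column are tree theorems, and the
fibre-class Lefschetz node (β′_f) of a compact pencil `f : 𝒳 ⟶ S` of abelian `d`-folds is EXACTLY the
cycle-theoretic statement "for each `p ≤ d`, `L = (· ∪ [𝒳_t]) : H²ᵖ(𝒳) → H²ᵖ⁺²(𝒳)` has a quasi-inverse induced by
a codimension-`d` algebraic cycle on `𝒳 × 𝒳`" (part X-b). This part settles the degree `p = 1` under ONE typed,
print-true hypothesis on ONE fibre, with the cycle written down:

* §0 `exists_reproducing_pairs_of_separating` — linear algebra (Mathlib's `BilinForm.dualBasis` on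
  `V / ker j`): for `j : V → U`, a subspace `N` with `j(N) = j(V)`, and a bilinear form `B` on `V` killing `ker j`
  on both sides and left-non-degenerate modulo `ker j`, there are `Aᵢ, Dᵢ ∈ N` with
  `j(∑ᵢ B(Aᵢ, w) • Dᵢ) = j(w)` for all `w`.
* §1 `exists_algebraic_lefschetzClass` — a global class `K ∈ N¹ H²(𝒳)` (pull-back of the generator of `H²(ℙᴺ)`
  along a projective embedding) with hard Lefschetz on EVERY fibre (variant of part XII-a's
  `exists_globalKaehlerClass` recording algebraicity).
* §2 `lefschetzPowTo_mem_supportedClasses_of_mem` — `Lᴷʲ(Nˡ) ⊆ Nˡ⁺ʲ` in the `lefschetzPowTo` spelling.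
* §3 **`fibreClassLefschetz_degOne_of_divisorSpan`** — for `d ≥ 2` and a point `t₀` with
  `j_{t₀}^* H²(𝒳) = j_{t₀}^*(N¹ H²(𝒳))` ("the invariant part of `H²(𝒳_{t₀})` is spanned by restrictions of
  divisor classes"): the `p = 1` clause of `FibreClassLefschetzOn hf`, i.e. `∃ T : H⁴(𝒳) → H²(𝒳)`,
  `IsAlgebraicCorrespondence (d+1) (d+1) 𝒳 𝒳 T ∧ ∀ W t s, j_s^* T(j_{t*} j_t^* W) = j_s^* W`. The correspondence
  is the action (part XIV-a `exists_crossTrace`) of `∑ᵢ pr₁^* Dᵢ ∪ pr₂^* Lᴷ^{d-2} Aᵢ`, `Aᵢ, Dᵢ ∈ N¹ H²(𝒳)` the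
  §0-dual bases for `B(A, W) = τ((W ∪ [𝒳_{t₀}]) ∪ Lᴷ^{d-2} A)` — PRODUCTS OF DIVISORS, codimension `d`. Inputs:
  Poincaré duality on `𝒳(ℂ)` (`isPerfPair_cupPairing_of_field_holds`), the kernel identity (κ) in degree `d-1`
  (part XII-e `fibreGysinKernelOn_holds`), hard Lefschetz `Lᴷ^{d-2} : H²(𝒳_{t₀}) ⥲ H^{2d-2}(𝒳_{t₀})`, fibre-class
  constancy (φ) (part XIII-e `fibreClassConstantOn_holds`) and flatness (`map_fiberι_eq_zero_of_eq_zero`).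

WHY the hypothesis (RING2-MAP AA2.40): a correspondence built from divisors acts as zero on the transcendental
part of `I₂ = j^* H²(𝒳)`, so the divisor construction needs `I₂ ⊆ j^*(N¹)`; this holds in print for every
NON-ISOTRIVIAL compact pencil of abelian surfaces (a flat line `Λ² H^{1,0}` forces a constant period map) and for
pencils with big monodromy, and trivially when `H²(𝒳)` is algebraic. It is stated here on ONE fibre; by (κ)+(φ)
the kernels `ker j_t^*` agree for all `t`, so one fibre is as good as all. Part XIV-c adds the extreme degrees
`p = 0`, `p = d` unconditionally (cycles `𝒳 × Hᵈ`, `Hᵈ × 𝒳`) and assembles (β′_f) for `d = 2`.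

References: Abdulali1994FamiliesAV (Conj. 5.3, Thm. 5.5 p. 1130); Andre1996Motifs (§6.3 Remarque 2, p. 33);
VoisinHodgeII2003 ((10.7), §9.2.4 Prop. 9.20); VoisinHodgeI2002 (§6.2.3 Thm. 6.25, §11.3.3 Lemma 11.41);
HatcherAT2002 (§3.3 Prop. 3.38); Fulton1998 (§19.1 Prop. 19.1.1, §19.2 Cor. 19.2); DeligneHodgeII1971 (4.1.1).
-/

noncomputable section

set_option linter.dupNamespace false

namespace Summit.HodgeConjecture.HodgeConjecture.Ring2.AbelianAll

open CategoryTheory AlgebraicGeometry MonoidalCategory CartesianMonoidalCategory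
open Literature.AlgebraicGeometry Literature.AlgebraicGeometry.Motives
open Literature.AlgebraicGeometry.HodgeTheory
open Literature.AlgebraicTopology.SingularHomology (singularCohomology cupProduct cupProduct_one'
  cupProduct_assoc cupProduct_gradedComm_holds singularCohomologyZeroEquiv cupPairing
  isPerfPair_cupPairing_of_field_holds)
open Literature.Geometry.Kaehler (HasHardLefschetzProperty)

/-! ## §0 Linear algebra: reproducing pairs for a bilinear form non-degenerate modulo `ker j` -/

/-- **Dual bases modulo a kernel.** Let `j : V → U` be linear (`V` finite-dimensional), `N ≤ V` a subspace
with `j(N) = j(V)`, and `B` a bilinear form on `V` whose left and right radicals contain `ker j` and which is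
LEFT-non-degenerate modulo `ker j` (`B(a, ·) = 0 ⟹ j a = 0`). Then there are finitely many `Aᵢ, Dᵢ ∈ N` with
`j(∑ᵢ B(Aᵢ, w) • Dᵢ) = j(w)` for every `w` (descend `B` to `V / ker j`, take a basis of images of `N` and its
`B`-dual basis, Mathlib's `LinearMap.BilinForm.dualBasis`). [folklore] -/
theorem exists_reproducing_pairs_of_separating {K V U : Type*} [Field K] [AddCommGroup V] [Module K V]
    [FiniteDimensional K V] [AddCommGroup U] [Module K U]
    (j : V →ₗ[K] U) (N : Submodule K V) (hN : ∀ v, ∃ n ∈ N, j n = j v)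
    (B : V →ₗ[K] V →ₗ[K] K)
    (hB₁ : ∀ a, j a = 0 → ∀ w, B a w = 0) (hB₂ : ∀ w, j w = 0 → ∀ a, B a w = 0)
    (hB₃ : ∀ a, (∀ w, B a w = 0) → j a = 0) :
    ∃ (r : ℕ) (A D : Fin r → V), (∀ i, A i ∈ N) ∧ (∀ i, D i ∈ N) ∧
      ∀ w, j (∑ i, B (A i) w • D i) = j w := by
  classical
  set P : Submodule K V := LinearMap.ker j with hP
  -- descend `B` in the first argument
  have hk₁ : P ≤ LinearMap.ker B := fun a ha ↦ by
    rw [LinearMap.mem_ker]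
    ext w
    exact hB₁ a (LinearMap.mem_ker.1 ha) w
  set B₁ : (V ⧸ P) →ₗ[K] V →ₗ[K] K := P.liftQ B hk₁ with hB₁def
  have hB₁_mk : ∀ a w, B₁ (Submodule.Quotient.mk a) w = B a w := fun a w ↦ rfl
  -- descend in the second argument
  have hk₂ : P ≤ LinearMap.ker B₁.flip := fun w hw ↦ by
    rw [LinearMap.mem_ker]
    refine LinearMap.ext fun q ↦ ?_
    obtain ⟨a, rfl⟩ := Submodule.mkQ_surjective P q
    change B₁ (Submodule.Quotient.mk a) w = 0
    rw [hB₁_mk]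
    exact hB₂ w (LinearMap.mem_ker.1 hw) a
  set Bq : (V ⧸ P) →ₗ[K] (V ⧸ P) →ₗ[K] K := (P.liftQ B₁.flip hk₂).flip with hBqdef
  have hBq_mk : ∀ a w, Bq (Submodule.Quotient.mk a) (Submodule.Quotient.mk w) = B a w := fun a w ↦ rfl
  -- non-degenerate
  have hnd : (Bq : LinearMap.BilinForm K (V ⧸ P)).Nondegenerate := by
    refine LinearMap.BilinForm.Nondegenerate.ofSeparatingLeft fun q hq ↦ ?_
    obtain ⟨a, rfl⟩ := Submodule.mkQ_surjective P q
    change Submodule.Quotient.mk a = (0 : V ⧸ P)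
    rw [Submodule.Quotient.mk_eq_zero]
    refine LinearMap.mem_ker.2 (hB₃ a fun w ↦ ?_)
    rw [← hBq_mk]
    exact hq _
  -- lifts to `N`
  have hlift : ∀ q : V ⧸ P, ∃ n ∈ N, Submodule.Quotient.mk n = q := fun q ↦ by
    obtain ⟨v, rfl⟩ := Submodule.mkQ_surjective P q
    obtain ⟨n, hn, hjn⟩ := hN v
    refine ⟨n, hn, ?_⟩
    change Submodule.Quotient.mk n = Submodule.Quotient.mk v
    rw [Submodule.Quotient.eq, hP, LinearMap.mem_ker, map_sub, hjn, sub_self]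
  -- bases
  set b := Module.finBasis K (V ⧸ P) with hb
  set b' := LinearMap.BilinForm.dualBasis (Bq : LinearMap.BilinForm K (V ⧸ P)) hnd b with hb'
  choose A hA hAq using fun i ↦ hlift (b' i)
  choose D hD hDq using fun i ↦ hlift (b i)
  refine ⟨_, A, D, hA, hD, fun w ↦ ?_⟩
  -- coordinates in the basis `b` are `Bq (b' i) q`
  have hcoord : ∀ (q : V ⧸ P) (i), Bq (b' i) q = b.repr q i := fun q i ↦ by
    conv_lhs => rw [← b.sum_repr q]
    rw [map_sum]
    simp_rw [map_smul, smul_eq_mul]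
    simp_rw [hb', LinearMap.BilinForm.apply_dualBasis_left, mul_ite, mul_one, mul_zero,
      Finset.sum_ite_eq' Finset.univ, Finset.mem_univ, if_true]
  have hq : Submodule.Quotient.mk (p := P) (∑ i, B (A i) w • D i) = Submodule.Quotient.mk w := by
    have h1 : Submodule.Quotient.mk (p := P) (∑ i, B (A i) w • D i) = ∑ i, B (A i) w • b i := by
      rw [← Submodule.mkQ_apply, map_sum]
      refine Finset.sum_congr rfl fun i _ ↦ ?_
      rw [map_smul, Submodule.mkQ_apply, hDq]
    rw [h1]
    conv_rhs => rw [← b.sum_repr (Submodule.Quotient.mk w)]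
    refine Finset.sum_congr rfl fun i _ ↦ ?_
    rw [← hcoord, ← hAq, hBq_mk]
  have hmem : j (∑ i, B (A i) w • D i - w) = 0 := LinearMap.mem_ker.1 ((Submodule.Quotient.eq P).1 hq)
  rwa [map_sub, sub_eq_zero] at hmem

variable {𝒳 S : SchemeOver ℂ}

/-! ## §1 A global ALGEBRAIC class with hard Lefschetz on every fibre -/

/-- **A global algebraic Lefschetz class.** On the total space `𝒳` of a compact pencil of abelian `d`-folds there
is a class `K ∈ N¹ H²(𝒳(ℂ); ℂ)` (the pull-back of a generator of `H²(ℙᴺ)` along a projective embedding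
`ε : 𝒳 ↪ ℙᴺ`; every class of `ℙᴺ` is algebraic and pull-backs preserve algebraic classes) whose restriction to
EVERY fibre `𝒳_s` has the hard Lefschetz property in dimension `d` (`𝒳_s ↪ 𝒳 ↪ ℙᴺ` is a closed immersion; the
tree's `hasHardLefschetzProperty_map_of_forall_eq_smul`). Variant of part XII-a's `exists_globalKaehlerClass`
recording algebraicity instead of the Kähler datum. [cite: VoisinHodgeI2002, §6.2.3 Thm. 6.25 and §11.1.2]
[cite: Fulton1998, §19.2 Cor. 19.2] -/
theorem exists_algebraic_lefschetzClass {d : ℕ} {f : 𝒳 ⟶ S} (hf : IsCompactAbelianPencil f d) :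
    ∃ K : complexBetti 𝒳 2, K ∈ algebraicClasses 𝒳 1 ∧
      ∀ s : ComplexPoints S, HasHardLefschetzProperty (complexBetti.map (fiberι f s) 2 K) d := by
  have h𝒳 := hf.isSmoothProjective_total
  obtain ⟨N, ε, hε⟩ := IsQuasiProjectiveOver.exists_isPreimmersion
    (IsQuasiProjectiveOver.of_isProjectiveOver h𝒳.isProjectiveOver)
  haveI := hε
  haveI : IsProper S.hom := IsSmoothProjective.isProper_holds hf.isSmoothProjective_base
  haveI : IsProper f.left := hf.isSmoothProjectiveFamily.isProper
  have hcl : ∀ s : ComplexPoints S, IsClosedImmersion (fiberι f s ≫ ε).left := fun s ↦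
    isClosedImmersion_fiberι_comp_left_of_isPreimmersion f ε s
  have hP : IsSmoothProjective N (projectiveSpace N ℂ) := isSmoothProjective_projectiveSpace' N
  obtain ⟨r₀, -, hr₀⟩ := exists_isRationalClass_forall_eq_smul_projectiveSpace N
  refine ⟨complexBetti.map ε 2 r₀, ?_, fun s ↦ ?_⟩
  · have hr : r₀ ∈ algebraicClasses (projectiveSpace N ℂ) 1 := by
      rw [algebraicClasses_projectiveSpace_eq_top]
      exact Submodule.mem_top
    exact map_mem_algebraicClasses_of_isAlgebraicCorrespondence h𝒳 hP
      (isAlgebraicCorrespondence_map h𝒳 hP ε (by omega)) hr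
  · haveI := hcl s
    have e : complexBetti.map (fiberι f s) 2 (complexBetti.map ε 2 r₀) = complexBetti.map (fiberι f s ≫ ε) 2 r₀ := by
      rw [complexBetti.map_comp, CategoryTheory.comp_apply]
    rw [e]
    exact hasHardLefschetzProperty_map_of_forall_eq_smul (hf.isSmoothProjective_fiberOver s) (fiberι f s ≫ ε) hr₀

/-! ## §2 Iterated Lefschetz operators of a divisor class preserve algebraic classes (degree-`m` spelling) -/

/-- `Lʲ_K (Nˡ H²ˡ) ⊆ Nˡ⁺ʲ Hᵐ`, `m = 2l + 2j`, for `K ∈ N¹ H²` on a smooth projective `X`, in the `lefschetzPowTo`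
spelling of the iterate (induction on `j` over the tree's `lefschetzOperator_mem_supportedClasses_of_mem`, Voisin
II Prop. 9.20 for a divisor). [cite: VoisinHodgeII2003, §9.2.4 Prop. 9.20] [cite: Fulton1998, §19.2 Cor. 19.2] -/
theorem lefschetzPowTo_mem_supportedClasses_of_mem {n : ℕ} {X : SchemeOver ℂ} (hX : IsSmoothProjective n X)
    {K : complexBetti X 2} (hK : K ∈ algebraicClasses X 1) (l : ℕ) {c : complexBetti X (2 * l)}
    (hc : c ∈ algebraicClasses X l) :
    ∀ (j m : ℕ) (hm : 2 * l + 2 * j = m), lefschetzPowTo K j (2 * l) m hm c ∈ supportedClasses X m (l + j)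
  | 0, m, hm => by
    subst hm
    exact hc
  | j + 1, m, hm => by
    rw [lefschetzPowTo_succ_apply K j (2 * l) (2 * l + 2 * j) m rfl hm (by omega)]
    exact lefschetzOperator_mem_supportedClasses_of_mem hX hK (l + j) (by omega) (by omega)
      (lefschetzPowTo_mem_supportedClasses_of_mem hX hK l hc j (2 * l + 2 * j) rfl)

/-! ## §3 The `p = 1` clause of (β′_f) from products of divisors -/

/-- **THE `p = 1` RUNG OF THE FIBRE-CLASS LEFSCHETZ OPERATOR FROM PRODUCTS OF DIVISORS (RING2-MAP AA2.39/40,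
owed item o15).** Let `f : 𝒳 ⟶ S` be a compact pencil of abelian `d`-folds, `d ≥ 2`, and suppose that on ONE
fibre `𝒳_{t₀}` the image `I₂ = j_{t₀}^* H²(𝒳(ℂ); ℂ)` is spanned by restrictions of divisor classes
(`∀ W, ∃ D ∈ N¹ H²(𝒳), j_{t₀}^* D = j_{t₀}^* W`; "the invariant part of `H²` of the fibre is Néron–Severi",
print-true for non-isotrivial pencils of abelian surfaces and for pencils with big monodromy). THEN the
degree-`1` clause of `FibreClassLefschetzOn hf` holds: there is `T : H⁴(𝒳(ℂ)) → H²(𝒳(ℂ))` INDUCED BY AN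
ALGEBRAIC CORRESPONDENCE with `j_s^* T(j_{t*} j_t^* W) = j_s^* W` for all `W, t, s` — EXPLICITLY the action of
the codimension-`d` cycle class `∑ᵢ pr₁^* Dᵢ ∪ pr₂^*(Lᴷ^{d-2} Aᵢ)` on `𝒳 × 𝒳` (`Dᵢ, Aᵢ` divisor classes, `K`
an algebraic hyperplane-type class: PRODUCTS OF DIVISORS), where `(Aᵢ), (Dᵢ)` are dual bases modulo `ker j_{t₀}^*`
for the form `B(A, W) = τ((W ∪ [𝒳_{t₀}]) ∪ Lᴷ^{d-2} A)` (§0). The three inputs of §0: `B` kills `ker j_{t₀}^*`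
on either side (projection formula, `j^*` multiplicative); `B(A, ·) = 0 ⟹ j_{t₀}^* A = 0` by Poincaré duality on
`𝒳` (`isPerfPair_cupPairing_of_field_holds`), the KERNEL IDENTITY (κ) in degree `d - 1` (part XII-e
`fibreGysinKernelOn_holds`) and HARD LEFSCHETZ `Lᴷ^{d-2} : H²(𝒳_{t₀}) ⥲ H^{2d-2}(𝒳_{t₀})` on the fibre; the
change of fibres `t₀ ↝ t, s` is (φ) (part XIII-e `fibreClassConstantOn_holds`) and flatness
(`map_fiberι_eq_zero_of_eq_zero`). NO Hodge-conjecture input, no named fact, no supply node.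
[cite: Abdulali1994FamiliesAV, Conjecture 5.3 and Theorem 5.5 (p. 1130)] [cite: Andre1996Motifs, §6.3 Remarque 2 (p. 33)]
[cite: VoisinHodgeII2003, proof of Thm. 10.17 (10.7) and §9.2.4 Prop. 9.20] [cite: HatcherAT2002, §3.3 Prop. 3.38]
[cite: VoisinHodgeI2002, §6.2.3 Thm. 6.25] -/
theorem fibreClassLefschetz_degOne_of_divisorSpan {d : ℕ} {f : 𝒳 ⟶ S} (hf : IsCompactAbelianPencil f d)
    (hd : 2 ≤ d) (t₀ : ComplexPoints S)
    (hN : ∀ W : complexBetti 𝒳 (2 * 1), ∃ D ∈ algebraicClasses 𝒳 1,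
      complexBetti.map (fiberι f t₀) (2 * 1) D = complexBetti.map (fiberι f t₀) (2 * 1) W) :
    ∃ T : complexBetti 𝒳 (2 * (1 + 1)) →ₗ[ℂ] complexBetti 𝒳 (2 * 1),
      IsAlgebraicCorrespondence (d + 1) (d + 1) 𝒳 𝒳 T ∧
        ∀ (W : complexBetti 𝒳 (2 * 1)) (t s : ComplexPoints S),
          complexBetti.map (fiberι f s) (2 * 1) (T (fiberGysin hf t 1 (complexBetti.map (fiberι f t) (2 * 1) W))) =
            complexBetti.map (fiberι f s) (2 * 1) W := by
  obtain ⟨e, rfl⟩ : ∃ e, d = e + 2 := ⟨d - 2, by omega⟩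
  have h𝒳 := hf.isSmoothProjective_total
  haveI : Module.Finite ℂ (complexBetti 𝒳 (2 * 1)) := finite_complexBetti h𝒳 _
  obtain ⟨K, hKalg, hKL⟩ := exists_algebraic_lefschetzClass hf
  obtain ⟨τ, hτ0, hτT⟩ := exists_crossTrace h𝒳 h𝒳
  -- notation: `j₀ = j_{t₀}^*`, `L = j_{t₀*} j_{t₀}^*`, `P = Lᴷ^{e}` on `H²(𝒳)`, the form `B`
  set j₀ : complexBetti 𝒳 (2 * 1) →ₗ[ℂ] complexBetti (fiberOver f t₀) (2 * 1) :=
    (complexBetti.map (fiberι f t₀) (2 * 1)).hom with hj₀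
  have hj₀apply : ∀ W, j₀ W = complexBetti.map (fiberι f t₀) (2 * 1) W := fun _ ↦ rfl
  set L : complexBetti 𝒳 (2 * 1) →ₗ[ℂ] complexBetti 𝒳 (2 * (1 + 1)) := fiberGysin hf t₀ 1 ∘ₗ j₀ with hL
  have hLapply : ∀ W, L W = fiberGysin hf t₀ 1 (complexBetti.map (fiberι f t₀) (2 * 1) W) := fun _ ↦ rfl
  have hpow : 2 * 1 + 2 * e = 2 * (e + 1) := by omega
  set P : complexBetti 𝒳 (2 * 1) →ₗ[ℂ] complexBetti 𝒳 (2 * (e + 1)) :=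
    lefschetzPowTo K e (2 * 1) (2 * (e + 1)) hpow with hP
  have hak : 2 * (1 + 1) + 2 * (e + 1) = 2 * (e + 2 + 1) := by omega
  set B : complexBetti 𝒳 (2 * 1) →ₗ[ℂ] complexBetti 𝒳 (2 * 1) →ₗ[ℂ] ℂ :=
    (((cupProduct hak).compl₁₂ L P).compr₂ τ).flip with hB
  have hBapply : ∀ A W, B A W = τ (cupProduct hak (L W) (P A)) := fun _ _ ↦ rfl
  -- restriction of `P A` to a fibre, and hard Lefschetz there
  have hPres : ∀ (t : ComplexPoints S) (A : complexBetti 𝒳 (2 * 1)),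
      complexBetti.map (fiberι f t) (2 * (e + 1)) (P A) =
        lefschetzPowTo (complexBetti.map (fiberι f t) 2 K) e (2 * 1) (2 * (e + 1)) hpow
          (complexBetti.map (fiberι f t) (2 * 1) A) :=
    fun t A ↦ map_fiberι_lefschetzPowTo t K e (2 * 1) (2 * (e + 1)) hpow A
  have hPinj : ∀ t : ComplexPoints S, Function.Injective
      (lefschetzPowTo (complexBetti.map (fiberι f t) 2 K) e (2 * 1) (2 * (e + 1)) hpow) := fun t ↦
    (bijective_lefschetzPowTo_of_hasHardLefschetz _ (hKL t) (show 2 * 1 + e = e + 2 by omega) _ hpow).1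
  -- the fibre class `F = [𝒳_{t₀}]` and `L W = W ∪ F`
  set F := fiberGysin hf t₀ 0 (singularCohomology.one ℂ (ComplexPoints (fiberOver f t₀))) with hF
  have hLW : ∀ W : complexBetti 𝒳 (2 * 1), L W =
      cupProduct (show 2 * 1 + 2 * (0 + 1) = 2 * (1 + 1) by ring) W F := fun W ↦
    fiberGysin_map_fiberι_eq_cupProduct hf t₀ W
  -- §0's three hypotheses
  have hB₂ : ∀ W, j₀ W = 0 → ∀ A, B A W = 0 := fun W hW A ↦ by
    rw [hBapply, hLapply, ← hj₀apply, hW, map_zero, map_zero, LinearMap.zero_apply, map_zero]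
  have hB₁ : ∀ A, j₀ A = 0 → ∀ W, B A W = 0 := fun A hA W ↦ by
    rw [hBapply]
    -- `(W ∪ F) ∪ P A = P A ∪ (W ∪ F) = P A ∪ j_* j^* W = j_*(j^*(P A) ∪ j^* W) = 0`
    have hcomm := cupProduct_gradedComm_holds ℂ _ hak (show 2 * (e + 1) + 2 * (1 + 1) = 2 * (e + 2 + 1) by omega)
      (L W) (P A)
    rw [hcomm, hLapply]
    have hproj := complexGysin_cup (μ := complexOrientationFamily) hasPoincareDuality_complexOrientationFamily
      (hf.isSmoothProjective_fiberOver t₀) h𝒳 (fiberι f t₀)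
      (show 2 * (e + 1) + 2 * 1 = 2 * (e + 2) by ring)
      (show 2 * (e + 2) + 2 * (e + 2 + 1) = 2 * (e + 2 + 1) + 2 * (e + 2) by ring)
      (show 2 * 1 + 2 * (e + 2 + 1) = 2 * (1 + 1) + 2 * (e + 2) by ring)
      (show 2 * (e + 1) + 2 * (1 + 1) = 2 * (e + 2 + 1) by ring) (P A)
      (complexBetti.map (fiberι f t₀) (2 * 1) W)
    have hfg : fiberGysin hf t₀ 1 (complexBetti.map (fiberι f t₀) (2 * 1) W) =
        complexGysin complexOrientationFamily (hf.isSmoothProjective_fiberOver t₀) h𝒳 (fiberι f t₀)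
          (show 2 * 1 + 2 * (e + 2 + 1) = 2 * (1 + 1) + 2 * (e + 2) by ring)
          (complexBetti.map (fiberι f t₀) (2 * 1) W) := rfl
    rw [hfg, ← hproj, hPres t₀ A, ← hj₀apply A, hA, map_zero, map_zero, LinearMap.zero_apply, map_zero,
      smul_zero, map_zero]
  have hB₃ : ∀ A, (∀ W, B A W = 0) → j₀ A = 0 := fun A hA ↦ by
    -- `τ` detects: `(W ∪ F) ∪ P A = 0` for all `W`
    have h1 : ∀ W : complexBetti 𝒳 (2 * 1), cupProduct hak (L W) (P A) = 0 := fun W ↦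
      hτ0 _ (by rw [← hBapply]; exact hA W)
    -- Poincaré duality on `𝒳`: `F ∪ P A = 0`
    have hFP : 2 * (0 + 1) + 2 * (e + 1) = 2 * (e + 1 + 1) := by ring
    have hdeg : 2 * 1 + 2 * (e + 1 + 1) = 2 * (e + 2 + 1) := by ring
    set y := cupProduct hFP F (P A) with hy
    have h2 : ∀ W : complexBetti 𝒳 (2 * 1), cupProduct hdeg W y = 0 := fun W ↦ by
      rw [hy, ← cupProduct_assoc (show 2 * 1 + 2 * (0 + 1) = 2 * (1 + 1) by ring) hFP hak hdeg, ← hLW W]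
      exact h1 W
    have hy0 : y = 0 := by
      letI := h𝒳.chartedSpace
      haveI := ComplexPoints.compactSpace_of_isSmoothProjective h𝒳
      haveI := ComplexPoints.t2Space_of_isSmoothProjective h𝒳
      have hPerf : (cupPairing (complexOrientationFamily h𝒳) hdeg).IsPerfPair :=
        isPerfPair_cupPairing_of_field_holds
      refine (LinearMap.IsPerfPair.bijective_right (cupPairing (complexOrientationFamily h𝒳) hdeg)).1 ?_
      rw [map_zero]
      ext W
      rw [LinearMap.flip_apply, LinearMap.zero_apply,
        Literature.AlgebraicTopology.SingularHomology.cupPairing_apply, h2 W, map_zero, LinearMap.zero_apply]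
    -- `P A ∪ F = j_{t₀*} j_{t₀}^*(P A) = 0`, so (κ) `j_{t₀}^*(P A) = 0`, so (hard Lefschetz) `j_{t₀}^* A = 0`
    have h3 : fiberGysin hf t₀ (e + 1) (complexBetti.map (fiberι f t₀) (2 * (e + 1)) (P A)) = 0 := by
      rw [fiberGysin_map_fiberι_eq_cupProduct hf t₀ (P A)]
      have hcomm := cupProduct_gradedComm_holds ℂ _ hFP
        (show 2 * (e + 1) + 2 * (0 + 1) = 2 * (e + 1 + 1) by ring) F (P A)
      rw [← hy, hy0, eq_comm, smul_eq_zero] at hcomm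
      rcases hcomm with h | h
      · exact absurd h (by simp)
      · exact h
    have h4 := fibreGysinKernelOn_holds hf (e + 1) t₀ t₀ (P A) h3
    rw [hPres t₀ A] at h4
    rw [hj₀apply]
    exact hPinj t₀ (by rw [h4, map_zero])
  -- §0: dual bases of divisor classes
  obtain ⟨r, A, D, hA, hD, hrep⟩ := exists_reproducing_pairs_of_separating j₀ (algebraicClasses 𝒳 1)
    (fun W ↦ hN W) B hB₁ hB₂ hB₃
  -- the correspondence `∑ᵢ pr₁^* Dᵢ ∪ pr₂^* P(Aᵢ)`
  have hPA : ∀ i, P (A i) ∈ algebraicClasses 𝒳 (e + 1) := fun i ↦ by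
    have h := lefschetzPowTo_mem_supportedClasses_of_mem h𝒳 hKalg 1 (hA i) e (2 * (e + 1)) hpow
    rwa [Nat.add_comm 1 e] at h
  obtain ⟨T, hT, hTc⟩ := hτT hak (show 1 ≤ e + 2 + 1 by omega) r D (fun i ↦ P (A i)) hD hPA
  refine ⟨T, hT, fun W t s ↦ ?_⟩
  -- `L_t = L_{t₀}` (φ), `T(L W) = ∑ B(Aᵢ, W) • Dᵢ`, and `ker j_s^* = ker j_{t₀}^*`
  rw [fiberGysin_map_fiberι_eq_of_const hf (fibreClassConstantOn_holds hf) t t₀ W, ← hLapply, hTc]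
  have hsum : (∑ i, τ (cupProduct hak (L W) (P (A i))) • D i) = ∑ i, B (A i) W • D i :=
    Finset.sum_congr rfl fun i _ ↦ by rw [hBapply]
  rw [hsum, ← sub_eq_zero, ← map_sub]
  refine map_fiberι_eq_zero_of_eq_zero hf (t := t₀) ?_ s
  rw [map_sub, sub_eq_zero]
  exact hrep W

end Summit.HodgeConjecture.HodgeConjecture.Ring2.AbelianAll

end
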